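import Literature.AlgebraicGeometry.Morphisms.ProjectiveSubschemeCutOutByHighDegreeEquations
import Literature.AlgebraicGeometry.Motives.ProjBaseChangeAny
import Mathlib.AlgebraicGeometry.IdealSheaf.Functorial
import Mathlib.AlgebraicGeometry.ProjectiveSpectrum.Functor
import HarnessLib

/-!
# Containment of projective subschemes is detected by high-degree forms, compatibly with base change

Topic `Literature/AlgebraicGeometry/Morphisms`, namespace `Literature.AlgebraicGeometry.Morphisms.ProjCech`.  THEOREMS ONLY (no definition, no
instance, no notation, no named fact, no `sorry`).  Cell `hodgecm-mathlib` (D-0151 ∕ FLOOR 0), P1 sub-line F-4 layer 2, sub-stub (II-b) (the Hom-SCHEME), brick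
**(b1)** «sub-families CONTAINED IN A FIXED closed `W` form a CLOSED sub-functor of the Hilbert functor» (B-p20 (g14)'s census
`CENSUS-F4-IIb-HomScheme` §2 (b1), road (i′)) — FILE 2B, THE AFFINE-LOCAL CORE: for `W ⊂ ℙ^r_A` closed (`A` Noetherian, or: homogeneous ideal generated
in degrees `≤ d`), an `A`-algebra `A'` and ANY closed `Z' ⊂ ℙ^r_{A'}`, **`Z' → ℙ^r_{A'} → ℙ^r_A` factors through `W` (i.e. `Z' ⊂ W_{A'}`) as soon as the
degree-`d` forms of the homogeneous ideal of `W` map into the homogeneous ideal of `Z'`** — and conversely in every degree.  Count-neutral Mathlib-side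
capital (`--supports stmt-HodgeConjecture-24835`); HC_CM is proved only modulo the 7 printed citations until rung 0 closes — nothing here is about HC.

THE PRINT.  [Kollar1996] I (1.10), proof, and [MumfordFogartyKirwan1994] Ch. 0 §5 (c) (p. 23): the Hom-scheme ∕ `Hilb(W/S)` is cut out of
`Hilb(ℙ/S)` by the vanishing of the restrictions to the universal family of the equations of `W`; the scheme-theoretic content is [Hartshorne1977] II
Cor. 5.16 (a) with Ex. 5.10 (a closed subscheme of `ℙ^r_A` is determined by its homogeneous ideal in large degrees: ★ FILE 1
`ProjectiveSubschemeCutOutByHighDegreeEquations`) and II Prop. 2.5 (b) ∕ the functoriality of `Proj` (Mathlib `Proj.map`, `Proj.awayToSection_comp_appLE`):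
on the chart `D₊(x_j)` the base-change map `ℙ^r_{A'} → ℙ^r_A` sends the function `g_d ∕ x_j^d` to `(g ⊗ 1)_d ∕ x_j^d`.

* §1 `awayEquiv_symm_fracB` (`g_d ∕ x_j^d` as Mathlib's `Away.mk`), `map_hcomp`, `mapGraded_Xs`, **`awayMap_fracB`** — `Away.map (A[x] → A'[x]) (g_d ∕ x_j^d)
  = (g ⊗ 1)_d ∕ x_j^d` (through Mathlib's `awayMap` along `x_j ↦ x_j · 1`); `quasiCompact_projMap` (base change of the affine `Spec A' → Spec A`, ★
  `ProjBaseChangeRing.isPullback_projMap'`).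
* §2 **`ker_le_ker_comp_projMap_of_map_hcomp_mem`** — if `𝔞(W)` is generated in degrees `≤ d` and `(g_d ⊗ 1) ∈ 𝔞(Z')` for all `g ∈ 𝔞(W)`, then
  `𝓘(W) ≤ 𝓘(Z' → ℙ^r_A)`, whence **`exists_comp_eq_comp_projMap`** — `Z' → ℙ^r_A` FACTORS THROUGH `W` (Mathlib `IsClosedImmersion.lift`); `A` Noetherian:
  **`exists_forall_exists_comp_eq_comp_projMap`** (`∃ d₀, ∀ d ≥ d₀`).
* §3 the converse **`map_mem_idealZ_of_comp_eq_comp_projMap`** — if `Z' → ℙ^r_A` factors through `W`, EVERY `g ∈ 𝔞(W)` maps into `𝔞(Z')`.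

## References
* [Kollar1996] J. Kollár, *Rational Curves on Algebraic Varieties* (1996), I Thm. 1.10 and its proof (Hom and Hilb of a closed subscheme).
* [MumfordFogartyKirwan1994] D. Mumford, J. Fogarty, F. Kirwan, *Geometric Invariant Theory*, 3rd ed. (1994), Ch. 0 §5 (c) (p. 23).
* [Hartshorne1977] R. Hartshorne, *Algebraic Geometry* (1977), II Prop. 2.5 (b) (p. 76), II Cor. 5.16 (a) (p. 119), II Ex. 5.10 (p. 125), II Ex. 3.11 (a) (p. 92).
-/

noncomputable section

-- `TopCat.Presheaf`/`Scheme.Modules` are not reducible (as in Mathlib's `AlgebraicGeometry/Modules`).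
set_option backward.isDefEq.respectTransparency false

universe u

-- needed to MENTION Mathlib's `Proj.awayToSection (grading A r)` (as in ★ `Morphisms/CechH1Projective`, ★ FILE 1)
-- (re-cut B-typ03 (g19): no `attribute [local instance] MvPolynomial.gradedAlgebra`; where the grading of `A[x₀,…,x_r]` is needed it is supplied inline by `letI`, pattern ★ `Motives/ChowZeroSupportedOnHyperplaneSectionOfDegreeLE`)

open CategoryTheory CategoryTheory.Limits AlgebraicGeometry TopologicalSpace Opposite HomogeneousLocalization
open Literature.Algebra.Homology Literature.Algebra.Homology.LaurentCech
open Literature.AlgebraicGeometry.Modules.SerreTwist (isAffineOpen_Zop)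
open Literature.AlgebraicGeometry.Motives.ProjBaseChangeRing (mapGraded mapGraded_apply irrelevant_le_map isPullback_projMap')

namespace Literature.AlgebraicGeometry.Morphisms

namespace ProjCech

/-! ## §1 Chart algebra of the base change `ℙ^r_{A'} → ℙ^r_A` -/

section ChartAlgebra

variable {A : Type u} [CommRing A] {r : ℕ}

/-- `g_d` is homogeneous of degree `d · #{j} = d`. [cite: Hartshorne1977, II Prop. 2.5 (b) (p. 76)] -/
theorem hcomp_mem_grading (j : Fin (r + 1)) (d : ℕ) (g : P A r) :
    hcomp (d : ℤ) g ∈ grading A r (d • ({j} : Finset (Fin (r + 1))).card) := by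
  rw [Finset.card_singleton, smul_eq_mul, mul_one, hcomp_natCast]
  exact MvPolynomial.homogeneousComponent_mem d g

/-- **`g_d ∕ x_j^d` as Mathlib's fraction**: under `(P_{(x_j)})₀ ≅ B_{{j}}`, `fracB A j d g` is `Away.mk _ d g_d`. [cite: Hartshorne1977, II Prop. 2.5 (b) (p. 76)] -/
theorem awayEquiv_symm_fracB (j : Fin (r + 1)) (d : ℕ) (g : P A r) :
    letI := MvPolynomial.gradedAlgebra (σ := Fin (r + 1)) (R := A)
    (awayEquiv A r {j}).symm (fracB A j d g) = Away.mk (grading A r) (Xs_mem {j}) d (hcomp (d : ℤ) g) (hcomp_mem_grading j d g) := by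
  letI := MvPolynomial.gradedAlgebra (σ := Fin (r + 1)) (R := A)
  rw [RingEquiv.symm_apply_eq]
  apply Subtype.ext
  rw [coe_awayEquiv, coe_fracB, awayToL_mk]
  rfl

variable {A' : Type u} [CommRing A']

/-- Homogeneous components commute with base change of coefficients. [cite: Hartshorne1977, II Prop. 2.5 (b) (p. 76)] -/
theorem map_hcomp (φ : A →+* A') (c : ℤ) (g : P A r) : MvPolynomial.map φ (hcomp c g) = hcomp c (MvPolynomial.map φ g) := by
  rcases lt_or_ge c 0 with hc | hc
  · rw [hcomp_of_neg hc, hcomp_of_neg hc, map_zero]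
  · obtain ⟨n, rfl⟩ := Int.eq_ofNat_of_zero_le hc
    rw [hcomp_natCast, hcomp_natCast]
    ext m
    simp only [MvPolynomial.coeff_map, MvPolynomial.coeff_homogeneousComponent]
    split_ifs <;> simp

variable [Algebra A A']

/-- The base-change map fixes the chart denominators: `(x_s ⊗ 1) = x_s`. [cite: Hartshorne1977, II Prop. 2.5 (b) (p. 76)] -/
theorem mapGraded_Xs (s : Finset (Fin (r + 1))) : mapGraded A A' (Fin (r + 1)) (Xs A s) = Xs A' s := by
  rw [mapGraded_apply, Xs, Xs, map_prod]
  exact Finset.prod_congr rfl fun i _ => MvPolynomial.map_X _ i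

/-- `(x_j ⊗ 1) = x_j · 1`, the shape consumed by Mathlib's `HomogeneousLocalization.awayMap`. [cite: Hartshorne1977, II Prop. 2.5 (b) (p. 76)] -/
theorem mapGraded_Xs_eq_mul_one (s : Finset (Fin (r + 1))) : mapGraded A A' (Fin (r + 1)) (Xs A s) = Xs A' s * 1 := by
  rw [mapGraded_Xs, mul_one]

/-- **`Away.map (A[x] → A'[x]) (g_d ∕ x_j^d) = (g ⊗ 1)_d ∕ x_j^d`**, the right-hand side moved from the denominator `x_j` to the (equal) denominator
`x_j ⊗ 1` by Mathlib's `awayMap`. [cite: Hartshorne1977, II Prop. 2.5 (b) (p. 76)] -/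
theorem awayMap_fracB (j : Fin (r + 1)) (d : ℕ) (g : P A r) :
    letI := MvPolynomial.gradedAlgebra (σ := Fin (r + 1)) (R := A)
    letI := MvPolynomial.gradedAlgebra (σ := Fin (r + 1)) (R := A')
    Away.map (mapGraded A A' (Fin (r + 1))) (Xs A {j}) ((awayEquiv A r {j}).symm (fracB A j d g)) =
      awayMap (grading A' r) (SetLike.one_mem_graded (grading A' r)) (mapGraded_Xs_eq_mul_one (A := A) (A' := A') {j})
        ((awayEquiv A' r {j}).symm (fracB A' j d (MvPolynomial.map (algebraMap A A') g))) := by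
  letI := MvPolynomial.gradedAlgebra (σ := Fin (r + 1)) (R := A)
  letI := MvPolynomial.gradedAlgebra (σ := Fin (r + 1)) (R := A')
  rw [awayEquiv_symm_fracB, awayEquiv_symm_fracB, Away.map_mk, awayMap_mk]
  apply HomogeneousLocalization.val_injective
  rw [Away.val_mk, Away.val_mk]
  congr 1
  rw [one_pow, mul_one, mapGraded_apply, map_hcomp]

/-- The base change `ℙ^r_{A'} → ℙ^r_A` is quasi-compact (base change of the affine `Spec A' → Spec A`, ★ `isPullback_projMap'`). [cite: Hartshorne1977, II Ex. 3.11 (a) (p. 92)] -/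
theorem quasiCompact_projMap :
    letI := MvPolynomial.gradedAlgebra (σ := Fin (r + 1)) (R := A)
    letI := MvPolynomial.gradedAlgebra (σ := Fin (r + 1)) (R := A')
    QuasiCompact (Proj.map (mapGraded A A' (Fin (r + 1))) (irrelevant_le_map A A' (Fin (r + 1)))) := by
  letI := MvPolynomial.gradedAlgebra (σ := Fin (r + 1)) (R := A)
  letI := MvPolynomial.gradedAlgebra (σ := Fin (r + 1)) (R := A')
  exact AlgebraicGeometry.quasiCompact_isStableUnderBaseChange.of_isPullback (isPullback_projMap' A A' (n := r)).flip inferInstance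

end ChartAlgebra

/-! ## §2 Forms detect containment: `Z' ⊂ W_{A'}` from `𝔞(W)_d ⊗ 1 ⊆ 𝔞(Z')` -/

section Containment

variable {A : Type u} [CommRing A] {r : ℕ} {W : Scheme.{u}} (ιW : W ⟶ PP A r) [IsClosedImmersion ιW]
  {A' : Type u} [CommRing A'] [Algebra A A'] {Z' : Scheme.{u}} (ι' : Z' ⟶ PP A' r) [IsClosedImmersion ι']

omit [IsClosedImmersion ι'] in
/-- **The chart computation.**  For `g ∈ P = A[x₀, …, x_r]` with `(g ⊗ 1)_d ∈ 𝔞(Z')`, the function `g_d ∕ x_j^d ∈ Γ(ℙ^r_A, D₊(x_j))` is killed by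
`(Z' → ℙ^r_{A'} → ℙ^r_A)^♯`: it maps to `(g ⊗ 1)_d ∕ x_j^d` on `D₊(x_j ⊗ 1) = D₊(x_j)` (Mathlib `Proj.awayToSection_comp_appLE`, `Proj.awayMap_awayToSection`),
which vanishes on `Z' ∩ D₊(x_j)` by the definition of `𝔞(Z')`. [cite: Hartshorne1977, II Prop. 2.5 (b) (p. 76) and Cor. 5.16 (a) (p. 119)] -/
theorem comp_projMap_app_evalRing_fracB_eq_zero (j : Fin (r + 1)) (d : ℕ) {g : P A r}
    (hg : MvPolynomial.map (algebraMap A A') (hcomp (d : ℤ) g) ∈ idealZ ι') :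
    letI := MvPolynomial.gradedAlgebra (σ := Fin (r + 1)) (R := A)
    letI := MvPolynomial.gradedAlgebra (σ := Fin (r + 1)) (R := A')
    (ι' ≫ Proj.map (mapGraded A A' (Fin (r + 1))) (irrelevant_le_map A A' (Fin (r + 1)))).app (Dplus A r {j})
      (show Γ(PP A r, Dplus A r {j}) from evalRing (𝟙 (PP A r)) {j} (fracB A j d g)) = 0 := by
  letI := MvPolynomial.gradedAlgebra (σ := Fin (r + 1)) (R := A)
  letI := MvPolynomial.gradedAlgebra (σ := Fin (r + 1)) (R := A')
  -- the target of the base-changed form vanishes on `Z' ∩ D₊(x_j)`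
  have hz : ι'.app (Dplus A' r {j}) (Proj.awayToSection (grading A' r) (Xs A' {j})
      ((awayEquiv A' r {j}).symm (fracB A' j d (MvPolynomial.map (algebraMap A A') g)))) = 0 := by
    have h := fracB_mem_ker_evalRing ι' hg j d
    rw [RingHom.mem_ker, map_hcomp, fracB_hcomp, if_pos rfl, evalRing_apply] at h
    exact h
  -- `Proj.map` on the chart: `awayToSection ≫ appLE = Away.map ≫ awayToSection`
  have hκ := congrArg (fun φ => φ.hom ((awayEquiv A r {j}).symm (fracB A j d g)))
    (Proj.awayToSection_comp_appLE (mapGraded A A' (Fin (r + 1))) (irrelevant_le_map A A' (Fin (r + 1))) (Xs_mem (A := A) {j}))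
  simp only [CommRingCat.hom_comp, RingHom.coe_comp, Function.comp_apply, CommRingCat.hom_ofHom] at hκ
  have hκ' : ((Proj.map (mapGraded A A' (Fin (r + 1))) (irrelevant_le_map A A' (Fin (r + 1)))).app (Dplus A r {j})).hom
      ((Proj.awayToSection (grading A r) (Xs A {j})).hom ((awayEquiv A r {j}).symm (fracB A j d g))) =
      (Proj.awayToSection (grading A' r) (mapGraded A A' (Fin (r + 1)) (Xs A {j}))).hom
        (Away.map (mapGraded A A' (Fin (r + 1))) (Xs A {j}) ((awayEquiv A r {j}).symm (fracB A j d g))) := by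
    rw [Scheme.Hom.app_eq_appLE]
    exact hκ
  -- move to the denominator `x_j`: restriction along `D₊(x_j ⊗ 1) ≤ D₊(x_j)`
  have hres := congrArg (fun φ => φ.hom ((awayEquiv A' r {j}).symm (fracB A' j d (MvPolynomial.map (algebraMap A A') g))))
    (Proj.awayMap_awayToSection (grading A' r) (g_deg := SetLike.one_mem_graded (grading A' r))
      (hx := mapGraded_Xs_eq_mul_one (A := A) (A' := A') {j}))
  simp only [CommRingCat.hom_comp, RingHom.coe_comp, Function.comp_apply, CommRingCat.hom_ofHom] at hres
  -- naturality of `ι'^♯`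
  have hnat := congrArg (fun φ => φ.hom ((Proj.awayToSection (grading A' r) (Xs A' {j})).hom
      ((awayEquiv A' r {j}).symm (fracB A' j d (MvPolynomial.map (algebraMap A A') g)))))
    (ι'.naturality (homOfLE (Proj.basicOpen_mono (grading A' r) _ _ ⟨_, mapGraded_Xs_eq_mul_one (A := A) (A' := A') {j}⟩)).op)
  simp only [CommRingCat.hom_comp, RingHom.coe_comp, Function.comp_apply] at hnat
  have hz' : (ι'.app (Dplus A' r {j})).hom ((Proj.awayToSection (grading A' r) (Xs A' {j})).hom
      ((awayEquiv A' r {j}).symm (fracB A' j d (MvPolynomial.map (algebraMap A A') g)))) = 0 := hz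
  -- assemble
  rw [evalRing_apply, Scheme.Hom.id_app, Scheme.Hom.comp_app]
  change (ι'.app _).hom (((Proj.map (mapGraded A A' (Fin (r + 1))) (irrelevant_le_map A A' (Fin (r + 1)))).app (Dplus A r {j})).hom
    ((Proj.awayToSection (grading A r) (Xs A {j})).hom ((awayEquiv A r {j}).symm (fracB A j d g)))) = 0
  rw [hκ', awayMap_fracB, hres]
  erw [hnat]
  rw [hz', map_zero]

/-- **Forms detect containment (ideal-sheaf letter).**  Let `W ⊂ ℙ^r_A` be closed with homogeneous ideal `𝔞(W)` generated by a set `S` of polynomials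
of total degree `≤ d`, and let `Z' ⊂ ℙ^r_{A'}` be closed (`A → A'` any algebra).  If `(g_d ⊗ 1) ∈ 𝔞(Z')` for every `g ∈ 𝔞(W)`, then
`𝓘(W) ≤ 𝓘(Z' → ℙ^r_A)` — chart by chart, `𝓘(W)|_{D₊(x_j)}` is generated by the `g_d ∕ x_j^d` (★ FILE 1 `ker_ideal_Dplus_eq_span_of_totalDegree_le`), each killed by
`(Z' → ℙ^r_A)^♯` (`comp_projMap_app_evalRing_fracB_eq_zero`). [cite: Hartshorne1977, II Cor. 5.16 (a) (p. 119) and Ex. 5.10 (p. 125)] [cite: Kollar1996, I Thm. 1.10 (proof)] -/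
theorem ker_le_ker_comp_projMap_of_map_hcomp_mem {S : Set (P A r)} (hS : Ideal.span S = idealZ ιW) {d : ℕ}
    (hSd : ∀ g ∈ S, g.totalDegree ≤ d) (h : ∀ g ∈ idealZ ιW, MvPolynomial.map (algebraMap A A') (hcomp (d : ℤ) g) ∈ idealZ ι') :
    letI := MvPolynomial.gradedAlgebra (σ := Fin (r + 1)) (R := A)
    letI := MvPolynomial.gradedAlgebra (σ := Fin (r + 1)) (R := A')
    ιW.ker ≤ (ι' ≫ Proj.map (mapGraded A A' (Fin (r + 1))) (irrelevant_le_map A A' (Fin (r + 1)))).ker := by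
  letI := MvPolynomial.gradedAlgebra (σ := Fin (r + 1)) (R := A)
  letI := MvPolynomial.gradedAlgebra (σ := Fin (r + 1)) (R := A')
  haveI := quasiCompact_projMap (A := A) (A' := A') (r := r)
  refine Scheme.IdealSheafData.le_of_iSup_eq_top
    (fun j : Fin (r + 1) => (⟨Dplus A r {j}, isAffineOpen_Zop (𝟙 (PP A r)) (Finset.singleton_nonempty j)⟩ : (PP A r).affineOpens))
    (iSup_cover_eq_top (𝟙 (PP A r))) fun j => ?_
  rw [ker_ideal_Dplus_eq_span_of_totalDegree_le ιW hS hSd j, Ideal.span_le]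
  rintro _ ⟨⟨g, hg⟩, rfl⟩
  rw [SetLike.mem_coe, Scheme.Hom.ker_apply, RingHom.mem_ker]
  exact comp_projMap_app_evalRing_fracB_eq_zero ι' j d (h g hg)

/-- **Forms detect containment (factorisation letter): `Z' ⊂ W_{A'}`**, i.e. `Z' → ℙ^r_{A'} → ℙ^r_A` FACTORS THROUGH `W ↪ ℙ^r_A`, under the hypotheses of
`ker_le_ker_comp_projMap_of_map_hcomp_mem` (Mathlib `IsClosedImmersion.lift`). [cite: Kollar1996, I Thm. 1.10 (proof)] [cite: Hartshorne1977, II Ex. 3.11 (a) (p. 92)] -/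
theorem exists_comp_eq_comp_projMap {S : Set (P A r)} (hS : Ideal.span S = idealZ ιW) {d : ℕ}
    (hSd : ∀ g ∈ S, g.totalDegree ≤ d) (h : ∀ g ∈ idealZ ιW, MvPolynomial.map (algebraMap A A') (hcomp (d : ℤ) g) ∈ idealZ ι') :
    letI := MvPolynomial.gradedAlgebra (σ := Fin (r + 1)) (R := A)
    letI := MvPolynomial.gradedAlgebra (σ := Fin (r + 1)) (R := A')
    ∃ jW : Z' ⟶ W, jW ≫ ιW = ι' ≫ Proj.map (mapGraded A A' (Fin (r + 1))) (irrelevant_le_map A A' (Fin (r + 1))) := by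
  letI := MvPolynomial.gradedAlgebra (σ := Fin (r + 1)) (R := A)
  letI := MvPolynomial.gradedAlgebra (σ := Fin (r + 1)) (R := A')
  exact ⟨IsClosedImmersion.lift ιW _ (ker_le_ker_comp_projMap_of_map_hcomp_mem ιW ι' hS hSd h),
    IsClosedImmersion.lift_fac ιW _ _⟩

/-- **`A` Noetherian: every `d ≫ 0` works.**  There is `d₀` such that for every `d ≥ d₀`, every algebra `A → A'` and every closed `Z' ⊂ ℙ^r_{A'}`:
if `(g_d ⊗ 1) ∈ 𝔞(Z')` for all `g ∈ 𝔞(W)`, then `Z' → ℙ^r_A` factors through `W` (★ FILE 1: `𝔞(W)` is finitely generated).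
[cite: Kollar1996, I Thm. 1.10 (proof)] [cite: Hartshorne1977, II Ex. 5.10 (p. 125)] -/
theorem exists_forall_exists_comp_eq_comp_projMap [IsNoetherianRing A] :
    ∃ d₀ : ℕ, ∀ d : ℕ, d₀ ≤ d → ∀ ⦃A' : Type u⦄ [CommRing A'] [Algebra A A'] ⦃Z' : Scheme.{u}⦄ (ι' : Z' ⟶ PP A' r) [IsClosedImmersion ι'],
      (∀ g ∈ idealZ ιW, MvPolynomial.map (algebraMap A A') (hcomp (d : ℤ) g) ∈ idealZ ι') →
      letI := MvPolynomial.gradedAlgebra (σ := Fin (r + 1)) (R := A)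
      letI := MvPolynomial.gradedAlgebra (σ := Fin (r + 1)) (R := A')
      ∃ jW : Z' ⟶ W, jW ≫ ιW = ι' ≫ Proj.map (mapGraded A A' (Fin (r + 1))) (irrelevant_le_map A A' (Fin (r + 1))) := by
  classical
  -- a finite generating set of `𝔞(W)` and the maximum of its degrees
  obtain ⟨S, hS⟩ := (isNoetherian_def.mp (inferInstance : IsNoetherian (P A r) (P A r))) (idealZ ιW)
  refine ⟨S.sup MvPolynomial.totalDegree, fun d hd A' _ _ Z' ι' _ h => ?_⟩
  exact exists_comp_eq_comp_projMap ιW ι' hS (fun g hg => (Finset.le_sup hg).trans hd) h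

end Containment

/-! ## §3 The converse: containment forces `𝔞(W) ⊗ 1 ⊆ 𝔞(Z')` in every degree -/

section Converse

variable {A : Type u} [CommRing A] {r : ℕ} {W : Scheme.{u}} (ιW : W ⟶ PP A r)
  {A' : Type u} [CommRing A'] [Algebra A A'] {Z' : Scheme.{u}} (ι' : Z' ⟶ PP A' r)

/-- Restriction of sections of `ℙ^r_{A'}` along `D₊(x_j ⊗ 1) ≤ D₊(x_j)` (equal opens) is injective. [cite: Hartshorne1977, II Prop. 2.5 (b) (p. 76)] -/
theorem presheaf_map_homOfLE_injective {X : Scheme.{u}} {U V : X.Opens} (h : U ≤ V) (h' : V ≤ U) :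
    Function.Injective (X.presheaf.map (homOfLE h).op) := by
  have hUV : U = V := le_antisymm h h'
  subst hUV
  rw [show homOfLE h = 𝟙 U from Subsingleton.elim _ _, op_id, X.presheaf.map_id]
  exact fun a b hab => hab

/-- **If `Z' → ℙ^r_A` factors through `W`, every form of `𝔞(W)` maps into `𝔞(Z')`.**  On the chart `D₊(x_j)`: `(g ⊗ 1)_b ∕ x_j^b` restricted to `Z'` is
`jW^♯` of `g_b ∕ x_j^b` restricted to `W`, which is `0`. [cite: Hartshorne1977, II Prop. 2.5 (b) (p. 76) and Cor. 5.16 (a) (p. 119)] [cite: Kollar1996, I Thm. 1.10 (proof)] -/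
theorem map_mem_idealZ_of_comp_eq_comp_projMap (jW : Z' ⟶ W)
    (hj : letI := MvPolynomial.gradedAlgebra (σ := Fin (r + 1)) (R := A)
      letI := MvPolynomial.gradedAlgebra (σ := Fin (r + 1)) (R := A')
      jW ≫ ιW = ι' ≫ Proj.map (mapGraded A A' (Fin (r + 1))) (irrelevant_le_map A A' (Fin (r + 1)))) {g : P A r}
    (hg : g ∈ idealZ ιW) : MvPolynomial.map (algebraMap A A') g ∈ idealZ ι' := by
  letI := MvPolynomial.gradedAlgebra (σ := Fin (r + 1)) (R := A)
  letI := MvPolynomial.gradedAlgebra (σ := Fin (r + 1)) (R := A')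
  rw [mem_idealZ]
  intro b j
  rcases lt_or_ge b 0 with hb | hb
  · rw [fracB_of_neg j hb, map_zero]
  obtain ⟨d, rfl⟩ := Int.eq_ofNat_of_zero_le hb
  -- the composite kills `g_d ∕ x_j^d`
  have key : (ι' ≫ Proj.map (mapGraded A A' (Fin (r + 1))) (irrelevant_le_map A A' (Fin (r + 1)))).app (Dplus A r {j})
      (show Γ(PP A r, Dplus A r {j}) from evalRing (𝟙 (PP A r)) {j} (fracB A j d g)) = 0 := by
    rw [← hj, Scheme.Hom.comp_app]
    change jW.app _ (ιW.app (Dplus A r {j}) (show Γ(PP A r, Dplus A r {j}) from evalRing (𝟙 (PP A r)) {j} (fracB A j d g))) = 0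
    rw [app_evalRing_id, show evalRing ιW {j} (fracB A j (d : ℤ) g) = 0 from (mem_idealZ ιW).mp hg d j, map_zero]
  -- unfold the composite as in §2, down to the restriction of `(g ⊗ 1)_d ∕ x_j^d` from `D₊(x_j)` to `D₊(x_j ⊗ 1)`
  rw [evalRing_apply, Scheme.Hom.id_app, Scheme.Hom.comp_app] at key
  change (ι'.app _).hom (((Proj.map (mapGraded A A' (Fin (r + 1))) (irrelevant_le_map A A' (Fin (r + 1)))).app (Dplus A r {j})).hom
    ((Proj.awayToSection (grading A r) (Xs A {j})).hom ((awayEquiv A r {j}).symm (fracB A j d g)))) = 0 at key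
  have hκ := congrArg (fun φ => φ.hom ((awayEquiv A r {j}).symm (fracB A j d g)))
    (Proj.awayToSection_comp_appLE (mapGraded A A' (Fin (r + 1))) (irrelevant_le_map A A' (Fin (r + 1))) (Xs_mem (A := A) {j}))
  simp only [CommRingCat.hom_comp, RingHom.coe_comp, Function.comp_apply, CommRingCat.hom_ofHom] at hκ
  have hκ' : ((Proj.map (mapGraded A A' (Fin (r + 1))) (irrelevant_le_map A A' (Fin (r + 1)))).app (Dplus A r {j})).hom
      ((Proj.awayToSection (grading A r) (Xs A {j})).hom ((awayEquiv A r {j}).symm (fracB A j d g))) =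
      (Proj.awayToSection (grading A' r) (mapGraded A A' (Fin (r + 1)) (Xs A {j}))).hom
        (Away.map (mapGraded A A' (Fin (r + 1))) (Xs A {j}) ((awayEquiv A r {j}).symm (fracB A j d g))) := by
    rw [Scheme.Hom.app_eq_appLE]
    exact hκ
  have hle : Proj.basicOpen (grading A' r) (mapGraded A A' (Fin (r + 1)) (Xs A {j})) ≤ Dplus A' r {j} :=
    Proj.basicOpen_mono (grading A' r) _ _ ⟨_, mapGraded_Xs_eq_mul_one (A := A) (A' := A') {j}⟩
  have hge : Dplus A' r {j} ≤ Proj.basicOpen (grading A' r) (mapGraded A A' (Fin (r + 1)) (Xs A {j})) := by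
    rw [mapGraded_Xs]
  have hres := congrArg (fun φ => φ.hom ((awayEquiv A' r {j}).symm (fracB A' j d (MvPolynomial.map (algebraMap A A') g))))
    (Proj.awayMap_awayToSection (grading A' r) (g_deg := SetLike.one_mem_graded (grading A' r))
      (hx := mapGraded_Xs_eq_mul_one (A := A) (A' := A') {j}))
  simp only [CommRingCat.hom_comp, RingHom.coe_comp, Function.comp_apply, CommRingCat.hom_ofHom] at hres
  have hnat := congrArg (fun φ => φ.hom ((Proj.awayToSection (grading A' r) (Xs A' {j})).hom
      ((awayEquiv A' r {j}).symm (fracB A' j d (MvPolynomial.map (algebraMap A A') g)))))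
    (ι'.naturality (homOfLE hle).op)
  simp only [CommRingCat.hom_comp, RingHom.coe_comp, Function.comp_apply] at hnat
  rw [hκ', awayMap_fracB, hres] at key
  erw [hnat] at key
  -- the restriction on `Z'` is injective (equal opens), so the section on `Z' ∩ D₊(x_j)` vanishes
  change (ι'.app (Dplus A' r {j})).hom ((Proj.awayToSection (grading A' r) (Xs A' {j})).hom
      ((awayEquiv A' r {j}).symm (fracB A' j d (MvPolynomial.map (algebraMap A A') g)))) = 0
  refine presheaf_map_homOfLE_injective (ι'.preimage_mono hle) (ι'.preimage_mono hge) ?_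
  rw [map_zero]
  exact key

end Converse

end ProjCech

end Literature.AlgebraicGeometry.Morphisms

end
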